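import Mathlib.Algebra.Module.ZLattice.Covolume
import Mathlib.MeasureTheory.Measure.Haar.InnerProductSpace
import Mathlib.Analysis.InnerProductSpace.PiL2
import Mathlib.Analysis.SpecialFunctions.Exp
import Mathlib.Algebra.Group.Int.Even
import Literature.MathematicalPhysics.StatisticalMechanics.Crystallization
import HarnessLib

/-!
# Barrier: no lattice in `ℝ³` is universally optimal (Cohn–Kumar) — fcc loses to bcc for `e^{-|x|²}`

Topic: `Literature/Barriers/AtomisticToContinuum` (barrier catalogue of
`AtomisticToContinuum/Crystallization`, D-0021).

## The obstruction, as printed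

Cohn–Kumar (JAMS 20, 2007), §9 "The Euclidean case", after conjecturing (Conjecture 9.4 in the
journal, "Conjecture 32" of the arXiv numbering) that the hexagonal lattice, `E₈` and the Leech
lattice minimise every completely monotonic potential energy of squared distance among periodic
configurations of their density: "One consequence of this conjecture is that these lattices are
universally optimal configurations in Euclidean space. That appears to be a rare property, which
provably fails for lattices in dimensions 3, 5, 6, and 7. The unique optimal lattices in those
dimensions are the `A₃`, `D₅`, `E₆`, and `E₇` root lattices (see [Mar]). Each of these lattices has
higher energy than its dual lattice for the potential function `f(x) = e^{−x}`, when both lattices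
are rescaled to have unit density." (Energy of a periodic configuration for a potential `f` of
*squared* distance: `E_f(Λ) = ∑_{x ∈ Λ ∖ {0}} f(|x|²)` for a lattice, §9, p. 24 of the arXiv
version.) The `d = 8, 24` cases of the conjecture are now theorems (Cohn–Kumar–Miller–Radchenko–
Viazovska, Ann. Math. 2022, Theorem 1.4; their §1 on `d = 3`: "The case of three dimensions is
surprisingly tricky even to describe. For the potential function `r ↦ e^{−πr²}`, the appropriately
scaled face-centered cubic lattice is widely conjectured to be optimal among lattices of density
`ρ` as long as `ρ ≤ 1`, while the body-centered cubic lattice is conjectured to be optimal when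
`ρ ≥ 1`. At density 1, they have the same energy by Poisson summation, because they are dual to
each other … proofs seem to be well beyond present-day mathematics"); Bétermin–Šamaj–Travěnec
2022, §1.1: "The same minimality property is
conjectured by Cohn and Kumar to hold in dimension `d = 2` for the triangular lattice `A₂` whereas
it is known that no universal minimizer exists in dimension `d = 3` [Sarnak–Strömbergsson 2006]."
Blanc–Lewin 2015, §2.5 (Epstein zeta `ζ₃(S, s)`, unit density): "As opposed to what Ennola
conjectured, FCC cannot be the unique minimizer for all `s > 0`. Indeed, [the functional
equation] would imply that its dual, BCC, is a minimizer for some values of `s`."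

## Contents

* `fccUnitDensity`, `bccUnitDensity : Set ℝ³` — the face-centred cubic lattice
  `A₃ ≅ D₃ = {v ∈ ℤ³ : v₁ + v₂ + v₃ even}` (Conway–Sloane Ch. 4 §6.3) and its dual, the
  body-centred cubic lattice `A₃* ≅ D₃* = {v ∈ ℤ³ : v₁ ≡ v₂ ≡ v₃ mod 2}` (Ch. 4 §6.7/§7.1),
  rescaled to one point per unit volume (`D₃` has index `2` in `ℤ³`, covolume `2`, scale
  `2^{-1/3}`; `{v : v₁ ≡ v₂ ≡ v₃ (2)} = 2ℤ³ ∪ (2ℤ³ + (1,1,1))` has covolume `4`, scale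
  `4^{-1/3}`).
* `gaussianEnergy c S = ∑_{x ∈ S ∖ {0}} e^{-c |x|²}` (Cohn–Kumar's `E_f` for `f(x) = e^{-cx}`).
* `CohnKumar2007_fcc_gaussianEnergy_gt_bcc` (named fact, as printed): at unit density,
  `E_{e^{-x}}(A₃) > E_{e^{-x}}(A₃*)`, i.e. `gaussianEnergy 1 bcc < gaussianEnergy 1 fcc`
  (numerically `4.56859… < 4.56868…`).
* `NoUniversallyOptimalLattice3D` (the barrier): no `ℤ`-lattice of covolume `1` in `ℝ³`
  minimises all Gaussian energies `E_{e^{-c x}}`, `c > 0`, among `ℤ`-lattices of covolume `1`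
  ("provably fails for lattices in dimension 3"; universal optimality = optimality for every
  completely monotonic `f`, equivalently — Bernstein — for every Gaussian `e^{-c x}`, `c > 0`:
  Coulangeon–Schürmann 2011, §4, "or equivalently, due to Bernstein's theorem, for any
  exponential potential `f_c`, `c > 0`").
* `latticeConfiguration`, `latticeConfiguration_points`,
  `two_mul_energyPerParticle_latticeConfiguration` (audit 2026-08-15, proved): a Bravais lattice as
  the one-point-motif `PeriodicConfiguration 3` of the summit statement, and
  `2 · energyPerParticle (e^{-c r²}) = gaussianEnergy c` — the barrier's energy IS the summit's
  energy per particle (Blanc–Lewin (23)) for lattices. The PERIODIC form of the obstruction (no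
  periodic configuration of `ℝ³` is universally optimal) is recorded in the audit section below as
  a chain of printed theorems; being an assembled corollary rather than a printed statement, it is
  documentation, not a named fact (D-0014).

## Design choices / wording risks

* Cohn–Kumar define universal optimality among *periodic configurations of the same density*;
  the printed failure "for lattices" is witnessed among lattices (fcc vs. its dual), so we state
  the no-go with lattice competitors only (weaker hypothesis on the would-be optimum's rivals,
  hence the stronger reading of "fails"). Their one-line proof: a universally optimal lattice
  minimises steep Gaussians, hence maximises the minimal distance at unit density, hence is the
  densest lattice packing `A₃` (unique: Gauss; Conway–Sloane Ch. 1 §1.4), which loses to `A₃*`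
  at `c = 1`.
* Lattices are Mathlib's `Submodule ℤ` + `DiscreteTopology` + `IsZLattice ℝ`, density via
  `ZLattice.covolume` (Lebesgue measure of `EuclideanSpace ℝ (Fin 3)`); energies are `tsum`s
  (junk `0` if not summable — Gaussian lattice sums are summable, not needed to *state*).
* Relevance to Lennard-Jones is indirect and is stated only through the cited sources (see the
  BARRIER block): `r⁻¹² − r⁻⁶` is not completely monotonic; the fixed-density lattice problem
  in `ℝ³` alternates between fcc and bcc (Blanc–Lewin §2.5), and for Lennard-Jones-type
  energies between fcc, hcp and simple hexagonal phases (Bétermin–Šamaj–Travěnec §3.1).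

## Audit 2026-08-15 (D-0021 barrier audit): fact CONFIRMED (a theorem of the tree), blocking scope CONFIRMED, its justification EXTENDED from lattices to periodic configurations

*The fact.* `NoUniversallyOptimalLattice3D` is proved in the tree
(`NoUniversallyOptimalLattice3DDischarge.lean`: `NoUniversallyOptimalLattice3D_holds`, axioms
`propext`, `Classical.choice`, `Quot.sound`): a unit lattice minimising every Gaussian energy
among unit lattices has minimal norm `≥ 2^{1/3}` (steep Gaussians against fcc) and, by Poisson
duality against bcc, so has its dual; Gauss's theorem with rigidity then puts a vector of squared
norm `¾·2^{2/3} < 2^{1/3}` in the dual. The printed numerical comparison is proved as well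
(`NoUniversallyOptimalLattice3DProofs.lean`: `CohnKumar2007_fcc_gaussianEnergy_gt_bcc_holds`,
`4.5685938 < 4.5686846`). Every quotation of the block was re-read at the cited place (Cohn–Kumar,
arXiv p. 25; Cohn–Kumar–Miller–Radchenko–Viazovska, arXiv p. 5; Blanc–Lewin, arXiv p. 11;
Bétermin–Šamaj–Travěnec, p. 2; Sarnak–Strömbergsson only through the latter's citation — text
not held).

*Scope of the formal statement.* Candidate AND competitors are Bravais lattices — exactly what is
printed: "provably fails for lattices" (Cohn–Kumar §9), "it is known that no universal minimizer
exists in dimension `d = 3` [Sarnak–Strömbergsson]" (Bétermin–Šamaj–Travěnec §1.1, a statement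
about lattices), and Cohn–Kumar separate the two notions themselves: "Montgomery proved … that the
hexagonal lattice is universally optimal among all lattices in `ℝ²`, but that is a weaker assertion
than universal optimality among all periodic point configurations" (§9, arXiv p. 26). The
`blocks:` clause, however, is about "a single density- and potential-independent optimal
structure certified by linear-programming / Fourier-interpolation bounds" — a PERIODIC structure
(the expected Lennard-Jones minimiser hcp is not a Bravais lattice, `HcpNotBravais`), and such
certificates are stated for periodic configurations (Cohn–Kumar §9, Proposition 9.3 = arXiv
Proposition 31; Cohn–Kumar–Miller–Radchenko–Viazovska Theorem 1.4). For that scope the cited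
sentence is not enough, and the sources are careful not to claim it: "we are not aware of any
point configurations in `ℝ^d` that meet the optimal linear programming bounds" for `d ∉ {8, 24}`
(CKMRV §7, arXiv p. 48); "Linear programming bounds seem not to be sharp in `ℝⁿ` except when
`n = 1, 2, 8`, or `24`. We can't rule out the possibility of sharp bounds in other dimensions, but
nobody has been able to identify any plausible candidates" (Cohn 2016, §23, arXiv p. 32); for the
Gaussian core model in `d = 3` "proofs seem to be well beyond present-day mathematics" (CKMRV §1).

*The periodic statement is nevertheless a theorem, by a chain of printed results* (assembled in
this audit; not found stated as such — searched CKMRV §1 and §7, Cohn 2016 §10 and §22–23,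
Cohn–Kumar 2008 §1 and §9, Blanc–Lewin §2.5, Bétermin–Petrache §1–2, Bétermin–Šamaj–Travěnec §1).
Let `P ⊂ ℝ³` be periodic of density `1` with `2 e_c(P) ≤ E_c(L')` for every unit lattice `L'` and
every `c > 0` (`e_c` = Gaussian energy per particle, Blanc–Lewin (23); `E_c` = the lattice sum from
the origin, so `2 e_c(L) = E_c(L)` for a lattice).
(A) Against `L' =` fcc, steep Gaussians force min-distance² `≥ 2^{1/3}`, the fcc value:
"Universal optimality implies that `r_min` must be as large as possible for a periodic
configuration of point density `1`, which means the packing density is maximized" (Cohn–Kumar §9,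
arXiv p. 26; the tree's `le_norm_sq_of_gaussianEnergy_le` is the lattice case, and the argument —
`(1/m) e^{-c a_P} ≤ E_c(P) ≤ E_c(fcc) ≤ e^{-(c-1) 2^{1/3}} E_1(fcc)` — is the same for a motif of
`m` points). So `P` carries a periodic sphere packing of density `π/√18`, the maximum (Hales),
and that packing is saturated (room for one more ball would, by periodicity, be room for a
periodic family of balls of positive density).
(B) In Hales's formulation every vertex `v` of a saturated packing satisfies
`√32 ≤ vol Ω(v) + a(v)` for a negligible `a` (`∑_{v ∈ Λ(x,r)} a(v) ≤ C₁ r²`), the slack being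
`(8 pt − σ(D(v, Λ)))/(4 δ_oct)` (Lemma 1.5 with Theorem 1.6, "the maximum of the function `σ` …
is `8 pt`"; arXiv pp. 1–2). For a PERIODIC packing of density `π/√18` the Voronoi volumes average
to exactly `√32` over a period, so `∑_{Λ(x,r)} (vol Ω + a − √32) ≤ C r²` while every term is `≥ 0`
and recurs under the period lattice with positive spatial density: every term vanishes, i.e. every
decomposition star of `P` scores exactly `8 pt` (an elementary averaging step; not printed).
(C) "Let `D` be a decomposition star at which the maximum `8 pt` is attained. Then the set `U(D)`
of vectors at distance at most `2t₀` from the center has cardinality `12`. Up to Euclidean motion,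
`U(D)` is the kissing arrangement of the `12` balls around a central ball in the face-centered
cubic packing or hexagonal-close packing" (Hales, Theorem 1.7, arXiv p. 2); and "it is well known
that if the arrangement around each ball is either the FCC or HCP pattern, then the packing
consists of hexagonal layers" (Hales 2012, §1, citing *Dense Sphere Packings*). So `P` is a Barlow
stacking of triangular layers whose stacking sequence is periodic.
(D) Among ALL periodic layerings `Λ_s` of the triangular lattice with shifts in `H = {a, b, c}`
(Bétermin–Petrache, Definition 2.3 and Example 2.4: "the FCC lattice is `Λ_{s₁}` and the HCP
lattice is `Λ_{s₂}`") the `|H|`-periodic bijective sequences `s_b` — the fcc stackings — minimise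
`θ_{Λ_s}(α) = ∑ e^{-πα|p|²}` whenever `α ≥ 1/(2πt²)`, and "if the inequality … is strict then the
`s_b` as above exhaust all minimizers among periodic layerings" (Theorem 1.1); at unit density
`t² = ⅔·2^{1/3}`, so for every `c = πα > 0.5953`, in particular `c = 1`, every periodic stacking
other than fcc has strictly larger `e^{-c|x|²}`-energy than fcc; for hcp this holds at every `α`
("`θ_{FCC}(α) < θ_{HCP}(α)` … HCP has higher energy than the FCC for all completely monotone
interaction functions", Example 2.6).
(E) Hence `P` is the fcc lattice, and `E_1(fcc) > E_1(bcc)` (`CohnKumar2007_fcc_gaussianEnergy_gt_bcc`,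
proved) — contradiction. So NO periodic configuration of `ℝ³` is universally optimal, not even
against lattice competitors alone (in Lean terms: no `P : PeriodicConfiguration 3` with
`#F = covol G` has `2 · P.energyPerParticle (e^{-c r²}) ≤ gaussianEnergy c L'` for all unit lattices
`L'` and all `c > 0`; the one-point-motif case `P = latticeConfiguration L` is exactly the proved
barrier, by `two_mul_energyPerParticle_latticeConfiguration`). This assembled corollary is recorded
here as documentation only — it is not a printed statement, hence not a named fact (D-0014; review
of p34151). Numerically, at unit density `E_1(bcc) = 4.5685938 < E_1(fcc) = 4.5686846 < E_1(hcp) = 4.568736`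
and `E_π(fcc) = E_π(bcc) = 0.2315363` (audit computation, plain lattice sums, no certification
claimed beyond the two proved digits strings).

*What no theorem covers (the evasions, recorded in the block's `scope_caveats:`).* (i) POTENTIAL-SPECIFIC
two-point / Fourier certificates in `d = 3`: sharpness of the Cohn–Kumar bound for one fixed
Gaussian, or for Lennard-Jones at one density, is neither proved nor refuted ("can't rule out",
Cohn 2016 §23); only the hard-core endpoint is closed, for two-point certificates
(`Li2022_cohnElkies3D`). (ii) Lennard-Jones is not completely monotone, so universal optimality
would not by itself select its minimiser; the expected hcp preference is a one-well effect that is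
reversed for every completely monotone interaction (`θ_{FCC} < θ_{HCP}`, Bétermin–Petrache
Example 2.6). (iii) Non-periodic ground states — "phase coexistence … improves upon both of them
… in a way that seemingly cannot be achieved exactly by any periodic configuration" (CKMRV §1) —
are outside both statements, as are LP certificates matched by different structures at different
`c`.

## References (read at the cited places)

* H. Cohn, A. Kumar, *Universally optimal distribution of points on spheres*, J. AMS 20 (2007)
  99–148 (arXiv:math/0607446), §9 (arXiv pp. 24–25).
* H. Cohn, A. Kumar, S. D. Miller, D. Radchenko, M. Viazovska, *Universal optimality of the `E₈`
  and Leech lattices and interpolation formulas*, Ann. Math. 196 (2022) (arXiv:1902.05438).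
* R. Coulangeon, A. Schürmann, *Energy minimization, periodic sets and spherical designs*, IMRN
  2012 (arXiv:1005.4373), §4 (definitions; Corollary 4.5, Theorem 4.6).
* P. Sarnak, A. Strömbergsson, *Minima of Epstein's zeta function and heights of flat tori*,
  Invent. Math. 165 (2006).
* X. Blanc, M. Lewin, *The crystallization conjecture: a review* (2015), §2.5 (arXiv p. 11).
* L. Bétermin, L. Šamaj, I. Travěnec, Stud. Appl. Math. 150 (2022) (arXiv:2107.14020), §1.1,
  §2, §3.1.
* J. H. Conway, N. J. A. Sloane, *SPLAG*, 3rd ed.: Ch. 1 §1.4 (Gauss), Ch. 4 §6.3 (`D₃` = fcc);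
  Preface to the 3rd edition, "What are all the best sphere packings in low dimensions?" (the
  classification of the densest packings rests on "plausible but as yet unproved postulates").
* (audit) T. C. Hales, *The Kepler conjecture* (overview), arXiv:math/9811078 = Ann. Math. 162
  (2005): §1, Lemma 1.2, Lemma 1.5, Theorem 1.6, Theorem 1.7 (arXiv pp. 1–2).
* (audit) T. C. Hales, *A proof of Fejes Tóth's conjecture on sphere packings with kissing number
  twelve*, arXiv:1209.6043: §1 (p. 2, "well known … consists of hexagonal layers [DSP]", Theorem 1).
* (audit) L. Bétermin, M. Petrache, *Dimension reduction techniques for the minimization of theta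
  functions on lattices*, J. Math. Phys. 58 (2017) 071902, arXiv:1607.08716: Theorem 1.1 (p. 4),
  Definition 2.3, Example 2.4 (p. 10), Example 2.6 (p. 12).
* (audit) H. Cohn, *Packing, coding, and ground states* (PCMI lectures), arXiv:1603.05202: §23
  (p. 32).
* (audit) H. Cohn, A. Kumar, *Counterintuitive ground states in soft-core models*, Phys. Rev. E 78
  (2008) 061113, arXiv:0811.1236: §1 (p. 3: in `d = 3` the low-density Gaussian-core ground state
  is fcc, "lower energy than the competing hexagonally close-packed"), §3 (p. 5: the classification
  of tight packings is conjectural).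
-/

noncomputable section

open MeasureTheory

namespace Literature.Barriers.AtomisticToContinuum

/-! ## Gaussian energy, fcc and bcc at unit density -/

/-- The **Gaussian energy** `E_f(S) = ∑_{x ∈ S ∖ {0}} e^{-c |x|²}` of a point set `S ∋ 0` seen
from the origin, Cohn–Kumar's `f`-potential energy of a lattice for `f(x) = e^{-c x}` (`f` is
applied to the *squared* distance). A `tsum` (junk value `0` if not summable).
[cite: CohnKumar2006, §9 (energy of a periodic configuration)] -/
def gaussianEnergy (c : ℝ) (S : Set (EuclideanSpace ℝ (Fin 3))) : ℝ :=
  ∑' x : {x : EuclideanSpace ℝ (Fin 3) // x ∈ S ∧ x ≠ 0}, Real.exp (-c * ‖x.1‖ ^ 2)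

/-- The point of `ℝ³` with integer coordinates `v`, scaled by `t`. [folklore] -/
def scaledIntPoint (t : ℝ) (v : Fin 3 → ℤ) : EuclideanSpace ℝ (Fin 3) :=
  (WithLp.equiv 2 (Fin 3 → ℝ)).symm fun i => t * (v i : ℝ)

/-- **The face-centred cubic lattice at unit density**: `2^{-1/3} · D₃`,
`D₃ = {v ∈ ℤ³ : v₁ + v₂ + v₃ even}` ("the fcc consists of the points `(x,y,z)`, where `x, y`
and `z` are integers with an even sum", `det = 4`, i.e. covolume `2`), rescaled to one point per
unit volume. `A₃ ≅ D₃ ≅` fcc. [cite: ConwaySloane1999, Ch. 4 §6.3] -/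
def fccUnitDensity : Set (EuclideanSpace ℝ (Fin 3)) :=
  {x | ∃ v : Fin 3 → ℤ, Even (v 0 + v 1 + v 2) ∧ x = scaledIntPoint ((2 : ℝ) ^ (-(1 : ℝ) / 3)) v}

/-- **The body-centred cubic lattice at unit density**: `4^{-1/3} · {v ∈ ℤ³ : v₁ ≡ v₂ ≡ v₃ (2)}`
(`= 2ℤ³ ∪ (2ℤ³ + (1,1,1))`, covolume `4`), rescaled to one point per unit volume; bcc `≅ D₃*`,
the lattice dual to fcc. [cite: ConwaySloane1999, Ch. 4 §7.1 (D₃* = bcc)] -/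
def bccUnitDensity : Set (EuclideanSpace ℝ (Fin 3)) :=
  {x | ∃ v : Fin 3 → ℤ, (v 0 ≡ v 1 [ZMOD 2] ∧ v 1 ≡ v 2 [ZMOD 2]) ∧
    x = scaledIntPoint ((4 : ℝ) ^ (-(1 : ℝ) / 3)) v}

/-- The origin belongs to the fcc lattice. [folklore] -/
theorem zero_mem_fccUnitDensity : (0 : EuclideanSpace ℝ (Fin 3)) ∈ fccUnitDensity :=
  ⟨0, by simp, by ext i; simp [scaledIntPoint]⟩

/-- The origin belongs to the bcc lattice. [folklore] -/
theorem zero_mem_bccUnitDensity : (0 : EuclideanSpace ℝ (Fin 3)) ∈ bccUnitDensity :=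
  ⟨0, by simp, by ext i; simp [scaledIntPoint]⟩

/-! ## The named facts -/

/-- **Cohn–Kumar 2007, §9: at unit density fcc has larger `e^{-|x|²}`-energy than its dual bcc.**
"The unique optimal lattices in those dimensions are the `A₃`, `D₅`, `E₆`, and `E₇` root lattices
… Each of these lattices has higher energy than its dual lattice for the potential function
`f(x) = e^{−x}`, when both lattices are rescaled to have unit density." Here `d = 3`,
`A₃ =` fcc, `A₃* =` bcc: `∑_{x ∈ bcc₁∖0} e^{-|x|²} < ∑_{x ∈ fcc₁∖0} e^{-|x|²}` (numerically
`4.568594 < 4.568685`). [cite: CohnKumar2006, §9 (paragraph after Conjecture 9.4; arXiv p. 25)] -/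
def CohnKumar2007_fcc_gaussianEnergy_gt_bcc : Prop :=
  gaussianEnergy 1 bccUnitDensity < gaussianEnergy 1 fccUnitDensity

/-- **Barrier `NoUniversallyOptimalLattice3D`: universal optimality "provably fails for
lattices in dimension 3" (Cohn–Kumar 2007, §9).** There is no `ℤ`-lattice `L ⊂ ℝ³` of
covolume `1` whose Gaussian energies `∑_{x ∈ L∖0} e^{-c|x|²}` are, for every `c > 0`
simultaneously, minimal among `ℤ`-lattices of covolume `1` (universal optimality = minimality
for every completely monotonic potential of squared distance, equivalently, by Bernstein's
theorem, for every Gaussian `e^{-cx}`, `c > 0`: Coulangeon–Schürmann 2011, §4). Mechanism as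
printed: the only candidate is the densest lattice packing `A₃ =` fcc (Gauss), and fcc has
higher `e^{-|x|²}`-energy than its dual bcc at unit density
(`CohnKumar2007_fcc_gaussianEnergy_gt_bcc`).

BARRIER (D-0021; every clause is a citation, not an assessment)
* technique_class: universal-optimality lp-bound theta-function bravais-lattice-minimisation
* blocks: settling the energetic conjunct `Literature.StatMech.HasPeriodicGroundStateEnergy lennardJones 3` (which periodic configuration minimises, and that it does) through a single density- and potential-independent optimal structure certified by linear-programming / Fourier-interpolation bounds, the mechanism that proves universal optimality of `E₈` and the Leech lattice among periodic configurations [cite: CohnEtAl2019, Theorem 1.4] and is conjectured for the hexagonal lattice in `d = 2` [cite: CohnKumar2006, §9 Conjecture 9.4]: "it is known that no universal minimizer exists in dimension d = 3" [cite: BeterminSamajTravenec2022, §1.1 (p. 2)]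
* because: a universally optimal lattice of `ℝ³` would be the densest lattice packing, `A₃` = fcc alone [cite: ConwaySloane1999, Ch. 1 §1.4 (Gauss 1831)], yet "each of these lattices has higher energy than its dual lattice for the potential function f(x) = e^{−x}, when both lattices are rescaled to have unit density" [cite: CohnKumar2006, §9 (arXiv p. 25)]; for `r ↦ e^{-πr²}` fcc is conjectured optimal among lattices of density `ρ ≤ 1` and bcc for `ρ ≥ 1`, the two having equal energy at density `1` by Poisson summation, and near density `1` phase coexistence beats both — "the behavior of the Gaussian core model in three dimensions is more complex than one might expect from the case of lattices … proofs seem to be well beyond present-day mathematics" [cite: CohnEtAl2019, §1 (paragraph before Theorem 1.4)]; in Epstein-zeta terms "FCC cannot be the unique minimizer for all s > 0 … its dual, BCC, is a minimizer for some values of s", conjecturally fcc for `s > 3/2` and bcc for `0 < s < 3/2` [cite: BlancLewin2015, §2.5 (arXiv p. 11)] [cite: SarnakStrombergsson2006] [cite: BeterminSamajTravenec2022, §2 Conjecture 2.1]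
* evasions_known: potential- and density-specific lattice analysis in `d = 3` instead of a universal certificate — Ennola's local minimality of fcc for `ζ₃(·, s)`, `s > 0`, and Ryshkov's global minimality for large `s` [cite: BlancLewin2015, §2.5]; numerical phase diagrams (fcc / hcp / simple-hexagonal / bcc) for Lennard-Jones-type `(n, m)` lattice energies, with hcp entering only when adjoined by hand since it is not a Bravais lattice [cite: BeterminSamajTravenec2022, §1.2 and §3.1]; local universal optimality among periodic sets is available for `A₂, D₄, E₈, Λ₂₄` (all shells 4-designs), not in `d = 3` [cite: CoulangeonSchurmann2011, §4 Corollary 4.5 and Theorem 4.6]; "Most works consider only mono-atomic lattices. This excludes the HCP" [cite: BlancLewin2015, §2.5]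
* scope_caveats: AUDIT 2026-08-15 (D-0021 barrier audit; CONFIRMED — fact and blocking scope — with the justification extended, see the audit section of the module docstring): (a) the formal statement ranges over Bravais lattices for BOTH the candidate and its rivals, which is exactly the printed theorem — "provably fails for lattices" [cite: CohnKumar2006, §9 (arXiv p. 25)], "universally optimal among all lattices … is a weaker assertion than universal optimality among all periodic point configurations" [cite: CohnKumar2006, §9 (arXiv p. 26)], "no universal minimizer exists in dimension d = 3" said of lattices [cite: BeterminSamajTravenec2022, §1.1 (p. 2)] — and it is PROVED in the tree (`NoUniversallyOptimalLattice3D_holds`, `CohnKumar2007_fcc_gaussianEnergy_gt_bcc_holds`); (b) the periodic structures of the `blocks:` clause (hcp and the other close-packed polytypes are not Bravais lattices, `HcpNotBravais`) are NOT covered by that sentence, and the sources do not claim them: "we are not aware of any point configurations in ℝ^d that meet the optimal linear programming bounds" for d ∉ {8, 24} [cite: CohnEtAl2019, §7 (arXiv p. 48)], "We can't rule out the possibility of sharp bounds in other dimensions" [cite: Cohn2016, §23 (arXiv p. 32)]; they ARE covered by the chain of printed theorems recorded in the audit section (an assembled corollary, documentation only): universal optimality ⇒ densest periodic packing [cite: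 CohnKumar2006, §9 (arXiv p. 26)] ⇒ every decomposition star scores 8 pt (periodic averaging of Lemma 1.5 / Theorem 1.6) ⇒ twelve neighbours in the fcc or hcp pattern everywhere [cite: Hales1998, §1 Theorem 1.7 (arXiv p. 2)] ⇒ hexagonal layers [cite: Hales2012, §1 (p. 2)] ⇒ fcc, the unique minimiser of steep theta functions among periodic stackings [cite: BeterminPetrache2017, Theorem 1.1 and Example 2.4] ⇒ beaten by bcc at `c = 1` (this file); (c) not covered by any theorem: potential-specific (one Gaussian, or Lennard-Jones at one density) two-point/Fourier certificates in `d = 3` — open either way except at the hard-core endpoint (`Li2022_cohnElkies3D`) [cite: Cohn2016, §23 (arXiv p. 32)]; Lennard-Jones is not completely monotone and its expected hcp preference is reversed for every completely monotone interaction, `θ_FCC(α) < θ_HCP(α)` [cite: BeterminPetrache2017, Example 2.6]; non-periodic ground states (phase coexistence near density 1) [cite: CohnEtAl2019, §1 (paragraph before Theorem 1.4)]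
* status: theorem (Cohn–Kumar; the fcc/bcc Gaussian comparison is an explicit lattice-sum inequality)

[cite: CohnKumar2006, §9 (arXiv p. 25: "provably fails for lattices in dimensions 3, 5, 6, and 7")]
[cite: CoulangeonSchurmann2011, §4 (universal optimality via exponentials f_c)] -/
def NoUniversallyOptimalLattice3D : Prop :=
  ¬ ∃ (L : Submodule ℤ (EuclideanSpace ℝ (Fin 3))) (_ : DiscreteTopology L) (_ : IsZLattice ℝ L),
      ZLattice.covolume L = 1 ∧
      ∀ (L' : Submodule ℤ (EuclideanSpace ℝ (Fin 3))) (_ : DiscreteTopology L')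
        (_ : IsZLattice ℝ L'), ZLattice.covolume L' = 1 →
        ∀ c : ℝ, 0 < c →
          gaussianEnergy c (L : Set (EuclideanSpace ℝ (Fin 3))) ≤
            gaussianEnergy c (L' : Set (EuclideanSpace ℝ (Fin 3)))

/-- Unfolding the barrier: every unit-covolume lattice is beaten, for some Gaussian, by another
unit-covolume lattice. [cite: CohnKumar2006, §9] -/
theorem NoUniversallyOptimalLattice3D.exists_better (h : NoUniversallyOptimalLattice3D)
    (L : Submodule ℤ (EuclideanSpace ℝ (Fin 3))) [DiscreteTopology L] [IsZLattice ℝ L]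
    (hL : ZLattice.covolume L = 1) :
    ∃ (L' : Submodule ℤ (EuclideanSpace ℝ (Fin 3))) (_ : DiscreteTopology L')
      (_ : IsZLattice ℝ L') (c : ℝ), ZLattice.covolume L' = 1 ∧ 0 < c ∧
      gaussianEnergy c (L' : Set (EuclideanSpace ℝ (Fin 3))) <
        gaussianEnergy c (L : Set (EuclideanSpace ℝ (Fin 3))) := by
  by_contra hcon
  refine h ⟨L, ‹_›, ‹_›, hL, fun L' _ _ hL' c hc => ?_⟩
  by_contra hlt
  exact hcon ⟨L', ‹_›, ‹_›, c, hL', hc, lt_of_not_ge hlt⟩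

/-! ## Audit 2026-08-15: lattices as one-point-motif periodic configurations

The barrier's `gaussianEnergy c L` is twice the summit statement's energy per particle
`PeriodicConfiguration.energyPerParticle (fun r => e^{-c r²})` of the lattice `L` viewed as a
periodic configuration with motif `{0}` (Blanc–Lewin (23)); this is the dictionary used in step (E)
of the audit chain and by any consumer comparing the barrier with `HasPeriodicGroundStateEnergy`. -/

open Literature.MathematicalPhysics.StatisticalMechanics (PeriodicConfiguration)

/-- A Bravais lattice as a periodic configuration: lattice of periods `L`, one-point motif `{0}`
(Blanc–Lewin 2015, §2.1: "A Bravais (mono-atomic) lattice is the case `#F = 1`").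
[cite: BlancLewin2015, §2.1 (17)–(18)] -/
def latticeConfiguration (L : Submodule ℤ (EuclideanSpace ℝ (Fin 3))) [DiscreteTopology L]
    [IsZLattice ℝ L] : PeriodicConfiguration 3 where
  lattice := L
  discrete := ‹_›
  isZLattice := ‹_›
  motif := {0}
  motif_nonempty := ⟨0, by simp⟩
  eq_of_sub_mem := by
    intro x hx y hy _
    rw [Finset.mem_singleton] at hx hy
    rw [hx, hy]

/-- The point set of the one-point-motif configuration of `L` is `L`. [folklore] -/
theorem latticeConfiguration_points (L : Submodule ℤ (EuclideanSpace ℝ (Fin 3)))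
    [DiscreteTopology L] [IsZLattice ℝ L] :
    (latticeConfiguration L).points = (L : Set (EuclideanSpace ℝ (Fin 3))) := by
  ext z
  simp only [PeriodicConfiguration.points, latticeConfiguration, Finset.mem_singleton,
    Set.mem_setOf_eq, SetLike.mem_coe]
  constructor
  · rintro ⟨y, rfl, g, hg, rfl⟩
    simpa using hg
  · intro hz
    exact ⟨0, rfl, z, hz, by simp⟩

/-- **For a Bravais lattice, twice the energy per particle is the lattice sum from the origin**:
`2 e_c(L) = 2 · ½ ∑_{g ∈ L∖0} e^{-c|g|²} = E_c(L)` (Blanc–Lewin (23): "for a Bravais lattice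
(`F = {y}`) this is `½ ∑_{g ∈ G∖{0}} V(|g|)`"). [cite: BlancLewin2015, §2.1 (23)] -/
theorem two_mul_energyPerParticle_latticeConfiguration
    (L : Submodule ℤ (EuclideanSpace ℝ (Fin 3))) [DiscreteTopology L] [IsZLattice ℝ L] (c : ℝ) :
    2 * (latticeConfiguration L).energyPerParticle (fun r => Real.exp (-c * r ^ 2)) =
      gaussianEnergy c (L : Set (EuclideanSpace ℝ (Fin 3))) := by
  have hset : {y : EuclideanSpace ℝ (Fin 3) | y ∈ (latticeConfiguration L).points ∧ y ≠ 0} =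
      {x | x ∈ (L : Set (EuclideanSpace ℝ (Fin 3))) ∧ x ≠ 0} := by
    rw [latticeConfiguration_points]
  have hmotif : (latticeConfiguration L).motif = {0} := rfl
  unfold PeriodicConfiguration.energyPerParticle gaussianEnergy
  rw [hmotif, Finset.sum_singleton, Finset.card_singleton]
  rw [show (∑' y : {y : EuclideanSpace ℝ (Fin 3) // y ∈ (latticeConfiguration L).points ∧ y ≠ 0},
      Real.exp (-c * dist (0 : EuclideanSpace ℝ (Fin 3)) y.1 ^ 2))
      = ∑' y : ↥{y : EuclideanSpace ℝ (Fin 3) | y ∈ (latticeConfiguration L).points ∧ y ≠ 0},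
      Real.exp (-c * dist (0 : EuclideanSpace ℝ (Fin 3)) y.1 ^ 2) from rfl,
    tsum_congr_set_coe (fun y => Real.exp (-c * dist (0 : EuclideanSpace ℝ (Fin 3)) y ^ 2)) hset]
  rw [show (∑' x : {x : EuclideanSpace ℝ (Fin 3) // x ∈ (L : Set (EuclideanSpace ℝ (Fin 3))) ∧ x ≠ 0},
      Real.exp (-c * ‖x.1‖ ^ 2))
      = ∑' x : ↥{x : EuclideanSpace ℝ (Fin 3) | x ∈ (L : Set (EuclideanSpace ℝ (Fin 3))) ∧ x ≠ 0},
      Real.exp (-c * ‖x.1‖ ^ 2) from rfl]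
  simp only [dist_comm (0 : EuclideanSpace ℝ (Fin 3)), dist_zero_right]
  push_cast
  ring

end Literature.Barriers.AtomisticToContinuum

end
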